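import Literature.Probability.LatticeModels.IsingPlusEdwardsSokal
import HarnessLib

/-!
# The Edwards–Sokal coupling for a finite volume with plus-type boundary condition

Topic `Literature/Probability/LatticeModels` (family `crit-ising`). The tree proves two *instances* of
the Edwards–Sokal identity: the free two-point function (`edwardsSokal_twoPoint_holds`,
`RandomClusterProofs.lean`) and the plus-boundary one-point function of a box of `ℤ^d`
(`isingCorr_plus_box_eq_rcMeasure_real`, `IsingPlusEdwardsSokal.lean`). This file proves the
**coupling itself**, for the finite-volume Gibbs measure `isingMeasure G Λ β 0 (.fixed η)`
(`IsingModel.lean`) of an arbitrary finite volume `Λ` of an arbitrary locally finite graph `G`,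
at zero field, with a boundary condition `η` that is `+1` on the exterior boundary `∂ᵉˣΛ` (the only
boundary spins the Hamiltonian sees), in the form in which it is *used* (Grimmett 2006, Thm. 1.13 /
Thm. 4.91 "conditional on `ω`, the spins are constant on the open clusters, equal to `+1` on the
clusters meeting the boundary, and independent fair `±1` coin flips on the other clusters"):

* `isingMeasure_fixed_real_eq_edwardsSokal`: for every measurable set `T` of configurations,
  `μ^{η}_{Λ;β,0}(T) = ∑_{ω ⊆ ℰ^b_Λ} φ^{∂}_{⟨ℰ^b_Λ⟩,p,2}(ω) · ν_ω(T)`, `p = 1 - e^{-2β}`, where the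
  random-cluster measure is the tree's `rcMeasure` of the graph `esGraph G Λ` on the closed volume
  `Λ ∪ ∂ᵉˣΛ` (finite type `ClosedV G Λ`) with edge set `ℰ^b_Λ` (the edges touching `Λ`), wired on
  `∂ᵉˣΛ`, and `ν_ω(T) = colourFrac G Λ η T ω` is the fraction, among the `2^{k^∂(ω)-1}` interior
  configurations that are constant on the open clusters of `ω` (the clusters meeting `∂ᵉˣΛ` being
  `+1`), of those whose glued configuration lies in `T`;
* `half_mul_rcMeasure_real_le_isingMeasure_real` (**the coin flip**): if on a set `𝒲` of bond
  configurations there is an interior vertex `s(ω)`, not joined to `∂ᵉˣΛ` by open edges, such that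
  every cluster-constant configuration with spin `-1` at `s(ω)` (hence on the whole open cluster of
  `s(ω)`) lies in `T`, then `μ^{η}_{Λ}(T) ≥ ½ φ(𝒲)`.

These are the two ingredients through which crossing estimates for the critical FK-Ising model
(`FKIsingRSW.lean`) are transferred to the spin model (Chelkak–Duminil-Copin–Hongler 2016, §5.3,
proof of Cor. 1.7: "we now use the Edwards–Sokal coupling … with probability `1/2` this cluster has
spin `-1`"; Chelkak–Duminil-Copin–Hongler–Kemppainen–Smirnov 2014, Rem. 4).

## Proof

Grimmett 2006, §1.4 (1.17)–(1.19) with the wired boundary of §4.2, exactly as in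
`IsingPlusEdwardsSokal.lean` but for a general volume and a general event: interior configurations
`τ : Λ → {±1}` are the configurations of the closed volume equal to `+1` off `Λ` (`plusLift`,
`plusLiftEquiv`); the Boltzmann weight `exp(β ∑_{e ∈ ℰ^b_Λ} σ_e)` is expanded over edge subsets
(`exp_mul_sum_bondSpin_eq`); exchanging the sums, the weight of `T` is
`e^{β|ℰ^b|} ∑_ω p^{|ω|}(1-p)^{|ℰ^b∖ω|} · #{τ : glue τ ∈ T, τ⁺ constant on ω-clusters}` and the
partition function is the same with `#{…} = 2^{k^∂(ω)-1}` (`card_plusClusterConstant`); the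
random-cluster weight is `p^{|ω|}(1-p)^{|ℰ^b∖ω|} 2^{k^∂(ω)}` and the factor `2` cancels. For the
coin flip, flipping the open cluster of `s(ω)` is an involution of the cluster-constant plus
configurations reversing `σ_{s(ω)}` (`sum_boole_plus_bondSpin_mul_spinAt_of_not_reachable`), so
exactly half of them have `σ_{s(ω)} = -1`.

## References

* G. Grimmett, *The Random-Cluster Model*, Springer 2006: §1.4 Thm. 1.10, Thm. 1.13, eqs.
  (1.17)–(1.19); §4.2 (4.11)–(4.13); §4.6 Thm. 4.91 — bib key `Grimmett2006`.
* R. G. Edwards, A. D. Sokal, Phys. Rev. D 38 (1988) 2009–2012 — bib key `EdwardsSokal1988`.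
* D. Chelkak, H. Duminil-Copin, C. Hongler, *Crossing probabilities in topological rectangles for
  the critical planar FK-Ising model*, Electron. J. Probab. 21 (2016), §5.3 — bib key
  `ChelkakDuminilCopinHongler2016` (cited for the use, not needed for the proofs).
* D. Chelkak, H. Duminil-Copin, C. Hongler, A. Kemppainen, S. Smirnov, *Convergence of Ising
  interfaces to Schramm's SLE curves*, C. R. Math. Acad. Sci. Paris 352 (2014), Rem. 4 — bib key
  `CDHKSCRAS2014` (the use this file serves: the spin-interface tightness fact
  `spinInterface_traversalBound` of `InterfaceSLETightness.lean`).
-/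

noncomputable section

namespace Literature.Probability.LatticeModels

open MeasureTheory Finset SimpleGraph

variable {V : Type*} [DecidableEq V] (G : SimpleGraph V) [G.LocallyFinite] (Λ : Finset V)

/-! ### The closed volume and the Edwards–Sokal graph -/

/-- The closed volume `Λ ∪ ∂ᵉˣΛ` of a finite volume `Λ`: the vertices whose spins enter the
Hamiltonian `H^{η}_{Λ}` (Friedli–Velenik 2017, §3.1). [cite: FriedliVelenik2017, §3.1] -/
def closedVolume : Finset V := Λ ∪ outerBoundary G Λ

/-- The closed volume as a finite vertex type. [cite: FriedliVelenik2017, §3.1] -/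
abbrev ClosedV : Type _ := ↥(closedVolume G Λ)

/-- The inclusion of the closed volume in `V`. [folklore] -/
abbrev closedVEmb : ClosedV G Λ ↪ V := Function.Embedding.subtype _

variable {G Λ} in
/-- `Λ` lies in its closed volume. [folklore] -/
theorem mem_closedVolume_of_mem {x : V} (hx : x ∈ Λ) : x ∈ closedVolume G Λ :=
  Finset.mem_union_left _ hx

variable {G Λ} in
/-- A neighbour of a vertex of `Λ` lies in the closed volume. [folklore] -/
theorem mem_closedVolume_of_adj {x y : V} (hx : x ∈ Λ) (h : G.Adj x y) : y ∈ closedVolume G Λ := by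
  by_cases hy : y ∈ Λ
  · exact mem_closedVolume_of_mem hy
  · exact Finset.mem_union_right _ (mem_outerBoundary_iff.2 ⟨hy, x, hx, h.symm⟩)

variable {G Λ} in
/-- A vertex of the closed volume outside `Λ` lies on the exterior boundary. [folklore] -/
theorem mem_outerBoundary_of_mem_closedVolume {y : V} (hy : y ∈ closedVolume G Λ) (hyΛ : y ∉ Λ) :
    y ∈ outerBoundary G Λ := by
  rcases Finset.mem_union.1 hy with h | h
  · exact absurd h hyΛ
  · exact h

/-- The Edwards–Sokal edge set: the edges `ℰ^b_Λ` of `G` touching `Λ`, as pairs of the closed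
volume (Grimmett 2006, §4.2, the edges `𝔼_Λ`; Friedli–Velenik 2017, §3.1, `ℰ^b_Λ`).
[cite: Grimmett2006, §4.2] -/
def esEdges : Finset (Sym2 (ClosedV G Λ)) :=
  Finset.univ.filter fun e => (closedVEmb G Λ).sym2Map e ∈ edgesTouching G Λ

/-- The Edwards–Sokal graph: the spanning graph of the closed volume with edge set `ℰ^b_Λ`
(Grimmett 2006, §4.2). [cite: Grimmett2006, §4.2] -/
def esGraph : SimpleGraph (ClosedV G Λ) :=
  fromEdgeSet (↑(esEdges G Λ) : Set (Sym2 (ClosedV G Λ)))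

/-- Adjacency of the Edwards–Sokal graph is decidable (classically). [folklore] -/
instance : DecidableRel (esGraph G Λ).Adj := Classical.decRel _

/-- The wired set of the coupling: the exterior boundary `∂ᵉˣΛ`, i.e. the vertices of the closed
volume outside `Λ` (Grimmett 2006, §4.2, `∂Λ` wired). [cite: Grimmett2006, §4.2] -/
def esWired : Set (ClosedV G Λ) := {y | y.1 ∉ Λ}

variable {G Λ}

/-- Membership in the wired set. [cite: Grimmett2006, §4.2] -/
@[simp] theorem mem_esWired_iff {y : ClosedV G Λ} : y ∈ esWired G Λ ↔ y.1 ∉ Λ := Iff.rfl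

/-- Membership in the Edwards–Sokal edge set. [cite: Grimmett2006, §4.2] -/
theorem mem_esEdges_iff {e : Sym2 (ClosedV G Λ)} :
    e ∈ esEdges G Λ ↔ (closedVEmb G Λ).sym2Map e ∈ edgesTouching G Λ := by
  simp [esEdges]

/-- `s(a, b)` is an Edwards–Sokal edge iff it is an edge of `G` with an endpoint in `Λ`.
[cite: Grimmett2006, §4.2] -/
theorem mk_mem_esEdges_iff {a b : ClosedV G Λ} :
    s(a, b) ∈ esEdges G Λ ↔ G.Adj a.1 b.1 ∧ (a.1 ∈ Λ ∨ b.1 ∈ Λ) := by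
  rw [mem_esEdges_iff, Function.Embedding.sym2Map_apply, Sym2.map_mk, mem_edgesTouching_iff,
    mem_edgeSet]
  simp only [Function.Embedding.coe_subtype, Sym2.mem_iff]
  constructor
  · rintro ⟨h, x, hx, rfl | rfl⟩
    · exact ⟨h, Or.inl hx⟩
    · exact ⟨h, Or.inr hx⟩
  · rintro ⟨h, hx | hx⟩
    · exact ⟨h, a.1, hx, Or.inl rfl⟩
    · exact ⟨h, b.1, hx, Or.inr rfl⟩

/-- Edwards–Sokal edges are not loops. [folklore] -/
theorem not_isDiag_of_mem_esEdges {e : Sym2 (ClosedV G Λ)} (he : e ∈ esEdges G Λ) : ¬ e.IsDiag := by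
  induction e using Sym2.ind with
  | h a b =>
    rw [Sym2.mk_isDiag_iff]
    rintro rfl
    exact (mk_mem_esEdges_iff.1 he).1.ne rfl

/-- **The Edwards–Sokal edges are the edges touching `Λ`**: `ℰ^b_Λ` read on the closed volume.
[cite: FriedliVelenik2017, §3.1 (ℰ_Λ^b)] -/
theorem esEdges_map : (esEdges G Λ).map (closedVEmb G Λ).sym2Map = edgesTouching G Λ := by
  ext e
  rw [Finset.mem_map]
  constructor
  · rintro ⟨e', he', rfl⟩
    exact mem_esEdges_iff.1 he'
  · intro he
    obtain ⟨heG, x, hx, hxe⟩ := mem_edgesTouching_iff.1 he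
    induction e using Sym2.ind with
    | h a b =>
      rw [mem_edgeSet] at heG
      have hab : a ∈ closedVolume G Λ ∧ b ∈ closedVolume G Λ := by
        rcases Sym2.mem_iff.1 hxe with rfl | rfl
        · exact ⟨mem_closedVolume_of_mem hx, mem_closedVolume_of_adj hx heG⟩
        · exact ⟨mem_closedVolume_of_adj hx heG.symm, mem_closedVolume_of_mem hx⟩
      refine ⟨s(⟨a, hab.1⟩, ⟨b, hab.2⟩), ?_, ?_⟩
      · exact mem_esEdges_iff.2 (by
          rw [Function.Embedding.sym2Map_apply, Sym2.map_mk]; exact he)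
      · rw [Function.Embedding.sym2Map_apply, Sym2.map_mk]
        rfl

/-- Adjacency in the Edwards–Sokal graph. [cite: Grimmett2006, §4.2] -/
theorem esGraph_adj {a b : ClosedV G Λ} : (esGraph G Λ).Adj a b ↔ s(a, b) ∈ esEdges G Λ := by
  rw [esGraph, fromEdgeSet_adj, Finset.mem_coe]
  exact ⟨fun h => h.1, fun h => ⟨h, fun hab => not_isDiag_of_mem_esEdges h (Sym2.mk_isDiag_iff.2 hab)⟩⟩

/-- The edge set of the Edwards–Sokal graph is `ℰ^b_Λ`. [cite: Grimmett2006, §4.2] -/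
theorem edgeFinset_esGraph : (esGraph G Λ).edgeFinset = esEdges G Λ := by
  rw [← Finset.coe_inj, coe_edgeFinset, esGraph, edgeSet_fromEdgeSet]
  refine sdiff_eq_left.2 (Set.disjoint_left.2 fun e he hd => ?_)
  exact not_isDiag_of_mem_esEdges (Finset.mem_coe.1 he) hd

/-! ### Interior configurations as plus configurations of the closed volume -/

variable (G Λ) in
/-- The plus lift of an interior configuration `τ : Λ → {±1}` to the closed volume: `τ` on `Λ`,
`+1` on `∂ᵉˣΛ` (Friedli–Velenik 2017, §3.1, `Ω^+_Λ`). [cite: FriedliVelenik2017, §3.1 (Ω_Λ^+)] -/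
def plusLift (τ : Λ → ℤˣ) : SpinConfig (ClosedV G Λ) :=
  fun y => if h : y.1 ∈ Λ then τ ⟨y.1, h⟩ else 1

/-- The plus lift at a vertex of `Λ`. [cite: FriedliVelenik2017, §3.1] -/
theorem plusLift_apply_of_mem (τ : Λ → ℤˣ) (y : ClosedV G Λ) (h : y.1 ∈ Λ) :
    plusLift G Λ τ y = τ ⟨y.1, h⟩ := by
  simp [plusLift, h]

/-- The plus lift off `Λ` is `+1`. [cite: FriedliVelenik2017, §3.1] -/
theorem plusLift_apply_of_notMem (τ : Λ → ℤˣ) (y : ClosedV G Λ) (h : y.1 ∉ Λ) :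
    plusLift G Λ τ y = 1 := by
  simp [plusLift, h]

/-- For a boundary condition equal to `+1` on `∂ᵉˣΛ`, the glued configuration read on the closed
volume is the plus lift. [cite: FriedliVelenik2017, §3.1] -/
theorem glue_fixed_apply_closedV {η : SpinConfig V} (hη : ∀ y ∈ outerBoundary G Λ, η y = 1)
    (τ : Λ → ℤˣ) (y : ClosedV G Λ) : glue Λ τ (.fixed η) y.1 = plusLift G Λ τ y := by
  by_cases h : y.1 ∈ Λ
  · rw [glue_apply_of_mem _ _ _ h, plusLift_apply_of_mem τ y h]
  · rw [glue_apply_of_notMem _ _ _ h, plusLift_apply_of_notMem τ y h, BoundaryCondition.outside_fixed]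
    exact hη _ (mem_outerBoundary_of_mem_closedVolume y.2 h)

/-- Bond spins of the glued configuration on the edges touching `Λ` are those of the plus lift.
[cite: FriedliVelenik2017, §3.1] -/
theorem bondSpin_glue_fixed_sym2Map {η : SpinConfig V} (hη : ∀ y ∈ outerBoundary G Λ, η y = 1)
    (τ : Λ → ℤˣ) (e : Sym2 (ClosedV G Λ)) :
    bondSpin (glue Λ τ (.fixed η)) ((closedVEmb G Λ).sym2Map e) = bondSpin (plusLift G Λ τ) e := by
  induction e using Sym2.ind with
  | h a b =>
    rw [Function.Embedding.sym2Map_apply, Sym2.map_mk, bondSpin_mk, bondSpin_mk]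
    simp only [spinAt, Function.Embedding.coe_subtype, glue_fixed_apply_closedV hη]

/-- **The Boltzmann weight of the fixed-boundary volume, on the closed volume**: at zero field and
for `η = +1` on `∂ᵉˣΛ`, `w^{η}_{Λ}(τ) = exp(β ∑_{e ∈ ℰ^b_Λ} σ_e(τ⁺))`.
[cite: FriedliVelenik2017, §3.1, eqs. (3.6)–(3.7)] -/
theorem isingWeight_fixed_eq_exp_sum_esEdges {η : SpinConfig V} (hη : ∀ y ∈ outerBoundary G Λ, η y = 1)
    (β : ℝ) (τ : Λ → ℤˣ) :
    isingWeight G Λ β 0 (.fixed η) τ =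
      Real.exp (β * ∑ e ∈ esEdges G Λ, bondSpin (plusLift G Λ τ) e) := by
  have hI : interactionEdges G Λ (.fixed η) = edgesTouching G Λ := rfl
  rw [isingWeight, isingHamiltonian, hI, ← esEdges_map, Finset.sum_map]
  simp only [zero_mul, sub_zero, mul_neg, neg_mul, neg_neg, bondSpin_glue_fixed_sym2Map hη]

variable (G Λ) in
/-- Interior configurations ↔ configurations of the closed volume equal to `+1` on the wired set
`∂ᵉˣΛ`. [cite: FriedliVelenik2017, §3.1 (Ω_Λ^+)] -/
def plusLiftEquiv : (Λ → ℤˣ) ≃ {σ : SpinConfig (ClosedV G Λ) // ∀ w ∈ esWired G Λ, σ w = 1} where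
  toFun τ := ⟨plusLift G Λ τ, fun w hw => plusLift_apply_of_notMem τ w (mem_esWired_iff.1 hw)⟩
  invFun σ := fun x => σ.1 ⟨x.1, mem_closedVolume_of_mem x.2⟩
  left_inv τ := by
    funext x
    show plusLift G Λ τ ⟨x.1, mem_closedVolume_of_mem x.2⟩ = τ x
    rw [plusLift_apply_of_mem τ _ x.2]
  right_inv σ := by
    apply Subtype.ext
    funext y
    show plusLift G Λ (fun x => σ.1 ⟨x.1, mem_closedVolume_of_mem x.2⟩) y = σ.1 y
    by_cases h : y.1 ∈ Λ
    · rw [plusLift_apply_of_mem _ y h]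
    · rw [plusLift_apply_of_notMem _ y h]
      exact (σ.2 y (mem_esWired_iff.2 h)).symm

open scoped Classical in
/-- Sums over interior configurations are sums over the plus configurations of the closed volume.
[cite: FriedliVelenik2017, §3.1] -/
theorem sum_plusLift_eq (F : SpinConfig (ClosedV G Λ) → ℝ) :
    ∑ τ : Λ → ℤˣ, F (plusLift G Λ τ) =
      ∑ σ : SpinConfig (ClosedV G Λ), if ∀ w ∈ esWired G Λ, σ w = 1 then F σ else 0 := by
  rw [← Finset.sum_filter,
    Finset.sum_subtype (p := fun σ : SpinConfig (ClosedV G Λ) => ∀ w ∈ esWired G Λ, σ w = 1)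
      (Finset.univ.filter fun σ : SpinConfig (ClosedV G Λ) => ∀ w ∈ esWired G Λ, σ w = 1)
      (fun σ => by rw [Finset.mem_filter]; exact ⟨fun h => h.2, fun h => ⟨Finset.mem_univ _, h⟩⟩) F]
  exact Fintype.sum_equiv (plusLiftEquiv G Λ) _ _ fun τ => rfl

/-! ### The colouring fraction `ν_ω(T)` -/

variable (G Λ) in
open scoped Classical in
/-- The number of interior configurations whose plus lift is constant on the open clusters of `ω`
(the clusters meeting the wired boundary being `+1`) and whose glued configuration lies in `T`:
the numerator of the conditional probability of `T` given the bonds `ω` in the Edwards–Sokal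
coupling (Grimmett 2006, Thm. 1.13(b), Thm. 4.91(b)). [cite: Grimmett2006, §1.4 Thm. 1.13] -/
def esCount (η : SpinConfig V) (T : Set (SpinConfig V)) (ω : Finset (Sym2 (ClosedV G Λ))) : ℕ :=
  #(Finset.univ.filter fun τ : Λ → ℤˣ =>
    glue Λ τ (.fixed η) ∈ T ∧ ∀ e ∈ ω, bondSpin (plusLift G Λ τ) e = 1)

variable (G Λ) in
/-- The colouring fraction `ν_ω(T) = esCount / 2^{k^∂(ω) - 1}`: the conditional probability of the
spin event `T` given the bond configuration `ω` in the Edwards–Sokal coupling with the boundary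
cluster frozen to `+1` (Grimmett 2006, Thm. 1.13(b) and Thm. 4.91(b): uniform `±1` colouring of the
`k^∂(ω) - 1` clusters not meeting the boundary). [cite: Grimmett2006, §1.4 Thm. 1.13 and §4.6 Thm. 4.91] -/
def colourFrac (η : SpinConfig V) (T : Set (SpinConfig V)) (ω : Finset (Sym2 (ClosedV G Λ))) : ℝ :=
  (esCount G Λ η T ω : ℝ) /
    (2 : ℝ) ^ (clusterCount (↑ω : Percolation.BondConfig (ClosedV G Λ)) (esWired G Λ) - 1)

/-- The colouring fraction is nonnegative. [folklore] -/
theorem colourFrac_nonneg (η : SpinConfig V) (T : Set (SpinConfig V)) (ω : Finset (Sym2 (ClosedV G Λ))) :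
    0 ≤ colourFrac G Λ η T ω := by
  unfold colourFrac
  positivity

open scoped Classical in
/-- The count of compatible configurations in `T` as a sum of indicators over the plus
configurations of the closed volume. [cite: Grimmett2006, §1.4 eq. (1.19)] -/
theorem esCount_eq_sum (η : SpinConfig V) (T : Set (SpinConfig V)) (ω : Finset (Sym2 (ClosedV G Λ))) :
    (esCount G Λ η T ω : ℝ) =
      ∑ τ : Λ → ℤˣ, (if glue Λ τ (.fixed η) ∈ T then (1 : ℝ) else 0) *
        (if ∀ e ∈ ω, bondSpin (plusLift G Λ τ) e = 1 then (1 : ℝ) else 0) := by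
  rw [esCount, Finset.natCast_card_filter]
  refine Finset.sum_congr rfl fun τ _ => ?_
  by_cases h1 : glue Λ τ (.fixed η) ∈ T <;> by_cases h2 : ∀ e ∈ ω, bondSpin (plusLift G Λ τ) e = 1 <;>
    simp [h1, h2]

open scoped Classical in
/-- With `T = univ` the count is the number of plus/cluster-constant configurations,
`2^{k^∂(ω) - 1}` (`card_plusClusterConstant`). [cite: Grimmett2006, §1.4 eq. (1.19) and §4.2 eq. (4.12)] -/
theorem esCount_univ (η : SpinConfig V) (hne : (esWired G Λ).Nonempty) (ω : Finset (Sym2 (ClosedV G Λ))) :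
    (esCount G Λ η Set.univ ω : ℝ) =
      (2 : ℝ) ^ (clusterCount (↑ω : Percolation.BondConfig (ClosedV G Λ)) (esWired G Λ) - 1) := by
  rw [← sum_boole_plus_bondSpin_eq ω hne]
  simp_rw [ite_and]
  rw [← sum_plusLift_eq (fun σ => if ∀ e ∈ ω, bondSpin σ e = 1 then (1 : ℝ) else 0), esCount,
    Finset.natCast_card_filter]
  refine Finset.sum_congr rfl fun τ _ => ?_
  simp only [Set.mem_univ, true_and]

/-! ### The coupling identity -/

/-- Exchange of a weighted configuration sum with the edge-set sum. [folklore] -/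
private theorem sum_mul_sum_exchange {ι κ : Type*} [Fintype ι] (t : Finset κ) (c : ℝ)
    (Wt : κ → ℝ) (b : ι → ℝ) (i : ι → κ → ℝ) :
    ∑ x, b x * (c * ∑ k ∈ t, Wt k * i x k) = c * ∑ k ∈ t, Wt k * ∑ x, b x * i x k := by
  calc ∑ x, b x * (c * ∑ k ∈ t, Wt k * i x k)
      = ∑ x, ∑ k ∈ t, c * (Wt k * (b x * i x k)) := by
        refine Finset.sum_congr rfl fun x _ => ?_
        rw [Finset.mul_sum, Finset.mul_sum]
        refine Finset.sum_congr rfl fun k _ => ?_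
        ring
    _ = ∑ k ∈ t, ∑ x, c * (Wt k * (b x * i x k)) := Finset.sum_comm
    _ = c * ∑ k ∈ t, Wt k * ∑ x, b x * i x k := by
        rw [Finset.mul_sum]
        refine Finset.sum_congr rfl fun k _ => ?_
        rw [Finset.mul_sum, Finset.mul_sum]

/-- The wired set is nonempty as soon as the exterior boundary is. [folklore] -/
theorem esWired_nonempty (hne : (outerBoundary G Λ).Nonempty) : (esWired G Λ).Nonempty := by
  obtain ⟨y, hy⟩ := hne
  exact ⟨⟨y, Finset.mem_union_right _ hy⟩, (mem_outerBoundary_iff.1 hy).1⟩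

/-- The Boltzmann-weighted count of the interior configurations glued into `T`, expanded over
edge sets: `∑_{τ : glue τ ∈ T} w(τ) = e^{β|ℰ^b|} ∑_{ω ⊆ ℰ^b} p^{|ω|}(1-p)^{|ℰ^b∖ω|} esCount(T, ω)`.
[cite: Grimmett2006, §1.4 eqs. (1.17)–(1.19)] -/
theorem sum_isingWeight_filter_eq_sum_esCount {η : SpinConfig V}
    (hη : ∀ y ∈ outerBoundary G Λ, η y = 1) (β : ℝ) (T : Set (SpinConfig V)) [DecidablePred (· ∈ T)] :
    ∑ τ : Λ → ℤˣ with glue Λ τ (.fixed η) ∈ T, isingWeight G Λ β 0 (.fixed η) τ =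
      Real.exp β ^ #(esEdges G Λ) * ∑ ω ∈ (esEdges G Λ).powerset,
        fkIsingParam β ^ #ω * (1 - fkIsingParam β) ^ #(esEdges G Λ \ ω) * esCount G Λ η T ω := by
  classical
  have hET : (esGraph G Λ).edgeFinset = esEdges G Λ := edgeFinset_esGraph
  have hexp : ∀ σ : SpinConfig (ClosedV G Λ), Real.exp (β * ∑ e ∈ esEdges G Λ, bondSpin σ e) =
      Real.exp β ^ #(esEdges G Λ) * ∑ ω ∈ (esEdges G Λ).powerset,
        fkIsingParam β ^ #ω * (1 - fkIsingParam β) ^ #(esEdges G Λ \ ω) *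
          (if ∀ e ∈ ω, bondSpin σ e = 1 then 1 else 0) := by
    intro σ
    have h := exp_mul_sum_bondSpin_eq (esGraph G Λ) β σ
    rw [hET] at h
    exact h
  rw [Finset.sum_filter]
  have h1 : ∀ τ : Λ → ℤˣ, (if glue Λ τ (.fixed η) ∈ T then isingWeight G Λ β 0 (.fixed η) τ else 0) =
      (if glue Λ τ (.fixed η) ∈ T then (1 : ℝ) else 0) *
        (Real.exp β ^ #(esEdges G Λ) * ∑ ω ∈ (esEdges G Λ).powerset,
          fkIsingParam β ^ #ω * (1 - fkIsingParam β) ^ #(esEdges G Λ \ ω) *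
            (if ∀ e ∈ ω, bondSpin (plusLift G Λ τ) e = 1 then 1 else 0)) := by
    intro τ
    rw [isingWeight_fixed_eq_exp_sum_esEdges hη, hexp, boole_mul]
  simp_rw [h1]
  rw [sum_mul_sum_exchange]
  refine congrArg (Real.exp β ^ #(esEdges G Λ) * ·) (Finset.sum_congr rfl fun ω _ => ?_)
  rw [esCount_eq_sum]
  congr 1
  exact Finset.sum_congr rfl fun τ _ => by congr

/-- The partition function expanded over edge sets:
`Z^{η}_{Λ} = e^{β|ℰ^b|} ∑_{ω ⊆ ℰ^b} p^{|ω|}(1-p)^{|ℰ^b∖ω|} 2^{k^∂(ω)-1}`.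
[cite: Grimmett2006, §1.4 eq. (1.19) and §4.2 eq. (4.12)] -/
theorem isingPartitionFunction_fixed_eq_sum_clusterCount {η : SpinConfig V}
    (hη : ∀ y ∈ outerBoundary G Λ, η y = 1) (hne : (outerBoundary G Λ).Nonempty) (β : ℝ) :
    isingPartitionFunction G Λ β 0 (.fixed η) =
      Real.exp β ^ #(esEdges G Λ) * ∑ ω ∈ (esEdges G Λ).powerset,
        fkIsingParam β ^ #ω * (1 - fkIsingParam β) ^ #(esEdges G Λ \ ω) *
          (2 : ℝ) ^ (clusterCount (↑ω : Percolation.BondConfig (ClosedV G Λ)) (esWired G Λ) - 1) := by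
  classical
  have h := sum_isingWeight_filter_eq_sum_esCount (G := G) (Λ := Λ) hη β Set.univ
  simp only [Set.mem_univ, Finset.filter_true_of_mem (fun _ _ => trivial)] at h
  rw [isingPartitionFunction, h]
  refine congrArg (Real.exp β ^ #(esEdges G Λ) * ·) (Finset.sum_congr rfl fun ω _ => ?_)
  rw [esCount_univ η (esWired_nonempty hne)]

/-- **The Edwards–Sokal coupling with plus-type boundary condition** (Grimmett 2006, Thm. 1.13
with the wired boundary of §4.2, eqs. (4.11)–(4.13), for `q = 2` and Ising spins `±1`; Thm. 4.91;
Edwards–Sokal 1988): for a finite volume `Λ` of a locally finite graph with nonempty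
exterior boundary, a boundary condition `η = +1` on `∂ᵉˣΛ`, and every measurable set `T` of
configurations,
`μ^{η}_{Λ;β,0}(T) = ∑_{ω ⊆ ℰ^b_Λ} φ^{∂ᵉˣΛ}_{⟨ℰ^b_Λ⟩,p,2}(ω) · ν_ω(T)`, `p = 1 - e^{-2β}`:
the law of the spins is the `φ`-average of the uniform colouring of the open clusters with the
boundary cluster coloured `+1` (`colourFrac`). (An algebraic identity, valid for every real `β`;
for `β ≥ 0` the weights `φ(ω)` are those of the probability measure `rcMeasure`, `p ∈ [0, 1]`.)
[cite: Grimmett2006, §1.4 Thm. 1.13 and §4.2 eqs. (4.11)–(4.13)] -/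
theorem isingMeasure_fixed_real_eq_edwardsSokal (β : ℝ) {η : SpinConfig V}
    (hη : ∀ y ∈ outerBoundary G Λ, η y = 1) (hne : (outerBoundary G Λ).Nonempty)
    {T : Set (SpinConfig V)} (hT : MeasurableSet T) :
    (isingMeasure G Λ β 0 (.fixed η)).real T =
      ∑ ω ∈ (esEdges G Λ).powerset,
        rcWeight (esGraph G Λ) (fkIsingParam β) 2 (esWired G Λ) ω /
            rcPartitionFunction (esGraph G Λ) (fkIsingParam β) 2 (esWired G Λ) *
          colourFrac G Λ η T ω := by
  classical
  set E := esEdges G Λ with hE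
  set W := esWired G Λ with hW
  set p := fkIsingParam β with hpdef
  have hET : (esGraph G Λ).edgeFinset = E := edgeFinset_esGraph
  have hc : (0 : ℝ) < Real.exp β ^ #E := pow_pos (Real.exp_pos β) _
  set Wt : Finset (Sym2 (ClosedV G Λ)) → ℝ := fun ω => p ^ #ω * (1 - p) ^ #(E \ ω) with hWt
  set K : Finset (Sym2 (ClosedV G Λ)) → ℕ :=
    fun ω => clusterCount (↑ω : Percolation.BondConfig (ClosedV G Λ)) W with hK
  obtain ⟨w₀, hw₀⟩ := esWired_nonempty hne
  haveI : Nonempty (ClosedV G Λ) := ⟨w₀⟩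
  have h2K : ∀ ω, (2 : ℝ) ^ K ω = 2 * 2 ^ (K ω - 1) := by
    intro ω
    have hpos : 0 < K ω := clusterCount_pos _ _
    conv_lhs => rw [show K ω = (K ω - 1) + 1 by omega, pow_succ]
    ring
  -- the Ising side
  have hL : (isingMeasure G Λ β 0 (.fixed η)).real T =
      (∑ τ : Λ → ℤˣ with glue Λ τ (.fixed η) ∈ T, isingWeight G Λ β 0 (.fixed η) τ) /
        isingPartitionFunction G Λ β 0 (.fixed η) := by
    rw [Measure.real, isingMeasure_apply_of_measurableSet G Λ β 0 _ hT, ENNReal.toReal_ofReal]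
    exact div_nonneg (Finset.sum_nonneg fun τ _ => (isingWeight_pos G Λ β 0 _ τ).le)
      (isingPartitionFunction_pos G Λ β 0 _).le
  have hNum := sum_isingWeight_filter_eq_sum_esCount (G := G) (Λ := Λ) hη β T
  have hDen := isingPartitionFunction_fixed_eq_sum_clusterCount (G := G) (Λ := Λ) hη hne β
  -- the random-cluster side
  have hw : ∀ ω, rcWeight (esGraph G Λ) p 2 W ω = Wt ω * (2 : ℝ) ^ K ω := by
    intro ω
    rw [rcWeight, hET]
  have hZ : rcPartitionFunction (esGraph G Λ) p 2 W = 2 * ∑ ω ∈ E.powerset, Wt ω * (2 : ℝ) ^ (K ω - 1) := by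
    rw [rcPartitionFunction, hET, Finset.mul_sum]
    refine Finset.sum_congr rfl fun ω _ => ?_
    rw [hw, h2K]
    ring
  set D : ℝ := ∑ ω ∈ E.powerset, Wt ω * (2 : ℝ) ^ (K ω - 1) with hD
  have hDpos : 0 < D := by
    have h0 := isingPartitionFunction_pos G Λ β 0 (.fixed η)
    rw [hDen] at h0
    exact pos_of_mul_pos_right h0 hc.le
  -- compare
  rw [hL, hNum, hDen, mul_div_mul_left _ _ hc.ne', Finset.sum_div]
  refine Finset.sum_congr rfl fun ω _ => ?_
  have h2 : (2 : ℝ) ^ (K ω - 1) ≠ 0 := pow_ne_zero _ two_ne_zero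
  rw [hw, hZ, colourFrac, h2K]
  simp only [hWt, hK, hW, hE, hpdef] at h2 hDpos ⊢
  field_simp

/-! ### The coin flip: colouring a non-boundary cluster `-1` -/

/-- For a spin `u ∈ {±1}`, the indicator of `u = -1` is `(1 - u)/2`. [folklore] -/
theorem ite_units_eq_neg_one (u : ℤˣ) :
    (if u = -1 then (1 : ℝ) else 0) = (1 - ((u : ℤ) : ℝ)) / 2 := by
  rcases Int.units_eq_one_or u with rfl | rfl <;> norm_num

open scoped Classical in
/-- **Half of the cluster-constant plus configurations colour a given non-boundary cluster `-1`**
(Grimmett 2006, Thm. 1.13(b)/4.91(b): the non-boundary clusters receive independent fair colours):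
if `s` is not joined to the wired set by open edges of `ω`, then
`∑_σ 1{σ = 1 on ∂} 1_F(σ, ω) 1{σ_s = -1} = 2^{k^∂(ω)-1} / 2`. [cite: Grimmett2006, §1.4 Thm. 1.13] -/
theorem sum_boole_plus_bondSpin_mul_ite_eq_neg_one (ω : Finset (Sym2 (ClosedV G Λ)))
    (hne : (esWired G Λ).Nonempty) {s : ClosedV G Λ}
    (hs : ¬ ∃ w ∈ esWired G Λ, (Percolation.openGraph (↑ω : Percolation.BondConfig (ClosedV G Λ))).Reachable s w) :
    ∑ σ : SpinConfig (ClosedV G Λ),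
        (if (∀ w ∈ esWired G Λ, σ w = 1) ∧ ∀ e ∈ ω, bondSpin σ e = 1 then (1 : ℝ) else 0) *
          (if σ s = -1 then (1 : ℝ) else 0) =
      (2 : ℝ) ^ (clusterCount (↑ω : Percolation.BondConfig (ClosedV G Λ)) (esWired G Λ) - 1) / 2 := by
  classical
  have h1 := sum_boole_plus_bondSpin_eq ω hne
  have h0 := sum_boole_plus_bondSpin_mul_spinAt_of_not_reachable ω hs
  simp_rw [ite_units_eq_neg_one]
  have : ∀ σ : SpinConfig (ClosedV G Λ),
      (if (∀ w ∈ esWired G Λ, σ w = 1) ∧ ∀ e ∈ ω, bondSpin σ e = 1 then (1 : ℝ) else 0) *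
          ((1 - ((σ s : ℤ) : ℝ)) / 2) =
        (if (∀ w ∈ esWired G Λ, σ w = 1) ∧ ∀ e ∈ ω, bondSpin σ e = 1 then (1 : ℝ) else 0) / 2 -
          (if (∀ w ∈ esWired G Λ, σ w = 1) ∧ ∀ e ∈ ω, bondSpin σ e = 1 then (1 : ℝ) else 0) *
            spinAt s σ / 2 := by
    intro σ
    rw [spinAt]
    ring
  simp_rw [this]
  rw [Finset.sum_sub_distrib, ← Finset.sum_div, ← Finset.sum_div, h1, h0]
  ring

/-- On such an `ω`, at least half of the compatible interior configurations have spin `-1` at `s`,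
so if these all lie in `T` the colouring fraction of `T` is at least `1/2`. [cite: Grimmett2006, §1.4 Thm. 1.13] -/
theorem half_le_colourFrac {η : SpinConfig V} (hne : (esWired G Λ).Nonempty) {T : Set (SpinConfig V)}
    {ω : Finset (Sym2 (ClosedV G Λ))} {s : ClosedV G Λ}
    (hs : ¬ ∃ w ∈ esWired G Λ, (Percolation.openGraph (↑ω : Percolation.BondConfig (ClosedV G Λ))).Reachable s w)
    (hT : ∀ τ : Λ → ℤˣ, (∀ e ∈ ω, bondSpin (plusLift G Λ τ) e = 1) → plusLift G Λ τ s = -1 →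
      glue Λ τ (.fixed η) ∈ T) :
    1 / 2 ≤ colourFrac G Λ η T ω := by
  classical
  have h2 : (0 : ℝ) < (2 : ℝ) ^ (clusterCount (↑ω : Percolation.BondConfig (ClosedV G Λ)) (esWired G Λ) - 1) :=
    pow_pos two_pos _
  rw [colourFrac, le_div_iff₀ h2]
  -- the compatible configurations with `σ_s = -1` are counted by `esCount`
  have hle : ∑ τ : Λ → ℤˣ, (if ∀ e ∈ ω, bondSpin (plusLift G Λ τ) e = 1 then (1 : ℝ) else 0) *
        (if plusLift G Λ τ s = -1 then (1 : ℝ) else 0) ≤ (esCount G Λ η T ω : ℝ) := by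
    rw [esCount_eq_sum]
    refine Finset.sum_le_sum fun τ _ => ?_
    by_cases hc : ∀ e ∈ ω, bondSpin (plusLift G Λ τ) e = 1
    · by_cases hs' : plusLift G Λ τ s = -1
      · rw [if_pos hc, if_pos hs', if_pos (hT τ hc hs')]
      · rw [if_neg hs', mul_zero]
        positivity
    · rw [if_neg hc, zero_mul, mul_zero]
  have heq : ∑ τ : Λ → ℤˣ, (if ∀ e ∈ ω, bondSpin (plusLift G Λ τ) e = 1 then (1 : ℝ) else 0) *
        (if plusLift G Λ τ s = -1 then (1 : ℝ) else 0) =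
      (2 : ℝ) ^ (clusterCount (↑ω : Percolation.BondConfig (ClosedV G Λ)) (esWired G Λ) - 1) / 2 := by
    rw [← sum_boole_plus_bondSpin_mul_ite_eq_neg_one ω hne hs]
    rw [sum_plusLift_eq (fun σ => (if ∀ e ∈ ω, bondSpin σ e = 1 then (1 : ℝ) else 0) *
      (if σ s = -1 then (1 : ℝ) else 0))]
    refine Finset.sum_congr rfl fun σ _ => ?_
    by_cases hA : ∀ w ∈ esWired G Λ, σ w = 1
    · rw [if_pos hA]
      by_cases hC : ∀ e ∈ ω, bondSpin σ e = 1
      · rw [if_pos hC, if_pos (And.intro hA hC)]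
      · have hAC : ¬ ((∀ w ∈ esWired G Λ, σ w = 1) ∧ ∀ e ∈ ω, bondSpin σ e = 1) := fun h => hC h.2
        rw [if_neg hC, if_neg hAC]
    · have hAC : ¬ ((∀ w ∈ esWired G Λ, σ w = 1) ∧ ∀ e ∈ ω, bondSpin σ e = 1) := fun h => hA h.1
      rw [if_neg hA, if_neg hAC, zero_mul]
  linarith

/-- **The coin flip of the Edwards–Sokal coupling** (Grimmett 2006, Thm. 1.13(b)/4.91(b);
Chelkak–Duminil-Copin–Hongler 2016, §5.3: "with probability `1/2` this cluster has spin `-1`"):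
let `𝒲` be a set of bond configurations such that for every `ω ⊆ ℰ^b_Λ` in `𝒲` there is a vertex
`s(ω)` not joined to the wired boundary `∂ᵉˣΛ` by open edges of `ω`, with the property that every
interior configuration whose plus lift is constant on the open clusters of `ω` and equals `-1` at
`s(ω)` (hence on the whole open cluster of `s(ω)`) glues into `T`. Then
`μ^{η}_{Λ;β,0}(T) ≥ ½ · φ^{∂ᵉˣΛ}_{⟨ℰ^b_Λ⟩,p,2}(𝒲)`. [cite: Grimmett2006, §1.4 Thm. 1.13] -/
theorem half_mul_rcMeasure_real_le_isingMeasure_real {β : ℝ} (hβ : 0 ≤ β) {η : SpinConfig V}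
    (hη : ∀ y ∈ outerBoundary G Λ, η y = 1) (hne : (outerBoundary G Λ).Nonempty)
    {T : Set (SpinConfig V)} (hT : MeasurableSet T)
    (𝒲 : Set (Percolation.BondConfig (ClosedV G Λ)))
    (h𝒲 : ∀ ω : Finset (Sym2 (ClosedV G Λ)), ω ⊆ esEdges G Λ →
      (↑ω : Percolation.BondConfig (ClosedV G Λ)) ∈ 𝒲 →
      ∃ s : ClosedV G Λ,
        (¬ ∃ w ∈ esWired G Λ, (Percolation.openGraph (↑ω : Percolation.BondConfig (ClosedV G Λ))).Reachable s w) ∧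
        ∀ τ : Λ → ℤˣ, (∀ e ∈ ω, bondSpin (plusLift G Λ τ) e = 1) → plusLift G Λ τ s = -1 →
          glue Λ τ (.fixed η) ∈ T) :
    1 / 2 * (rcMeasure (esGraph G Λ) (fkIsingParam β) 2 (esWired G Λ)).real 𝒲 ≤
      (isingMeasure G Λ β 0 (.fixed η)).real T := by
  classical
  have hp : fkIsingParam β ∈ Set.Icc (0 : ℝ) 1 := fkIsingParam_mem_Icc hβ
  have hET : (esGraph G Λ).edgeFinset = esEdges G Λ := edgeFinset_esGraph
  have hZ := rcPartitionFunction_pos (esGraph G Λ) hp two_pos (esWired G Λ)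
  rw [isingMeasure_fixed_real_eq_edwardsSokal β hη hne hT,
    rcMeasure_real_apply (esGraph G Λ) hp two_pos (esWired G Λ) 𝒲, hET, Finset.mul_sum]
  refine Finset.sum_le_sum fun ω hω => ?_
  have hwnn : 0 ≤ rcWeight (esGraph G Λ) (fkIsingParam β) 2 (esWired G Λ) ω /
      rcPartitionFunction (esGraph G Λ) (fkIsingParam β) 2 (esWired G Λ) :=
    div_nonneg (rcWeight_nonneg _ hp two_pos.le _ ω) hZ.le
  by_cases hmem : (↑ω : Percolation.BondConfig (ClosedV G Λ)) ∈ 𝒲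
  · rw [if_pos hmem]
    obtain ⟨s, hs, hsT⟩ := h𝒲 ω (Finset.mem_powerset.1 hω) hmem
    have h := half_le_colourFrac (η := η) (esWired_nonempty hne) hs hsT
    calc 1 / 2 * (rcWeight (esGraph G Λ) (fkIsingParam β) 2 (esWired G Λ) ω /
          rcPartitionFunction (esGraph G Λ) (fkIsingParam β) 2 (esWired G Λ))
        = rcWeight (esGraph G Λ) (fkIsingParam β) 2 (esWired G Λ) ω /
            rcPartitionFunction (esGraph G Λ) (fkIsingParam β) 2 (esWired G Λ) * (1 / 2) := by ring
      _ ≤ _ := mul_le_mul_of_nonneg_left h hwnn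
  · rw [if_neg hmem, mul_zero]
    exact mul_nonneg hwnn (colourFrac_nonneg η T ω)

/-- A vertex not joined to the wired set lies in `Λ` (it is not itself wired), so in the coin flip
the flipped cluster is an interior one. [folklore] -/
theorem mem_of_not_reachable_esWired {ω : Percolation.BondConfig (ClosedV G Λ)} {s : ClosedV G Λ}
    (hs : ¬ ∃ w ∈ esWired G Λ, (Percolation.openGraph ω).Reachable s w) : s.1 ∈ Λ := by
  by_contra h
  exact hs ⟨s, h, SimpleGraph.Reachable.refl s⟩

/-- Compatible configurations are constant on open clusters: if the plus lift of `τ` has all bond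
spins of `ω` equal to `1` and spin `-1` at `s`, it is `-1` on the whole open cluster of `s`.
[cite: Grimmett2006, §1.4 Thm. 1.13] -/
theorem plusLift_eq_neg_one_of_reachable {τ : Λ → ℤˣ} {ω : Finset (Sym2 (ClosedV G Λ))}
    (hc : ∀ e ∈ ω, bondSpin (plusLift G Λ τ) e = 1) {s v : ClosedV G Λ} (hs : plusLift G Λ τ s = -1)
    (hv : (Percolation.openGraph (↑ω : Percolation.BondConfig (ClosedV G Λ))).Reachable s v) :
    plusLift G Λ τ v = -1 := by
  rw [← hs]
  exact (apply_eq_of_reachable ((forall_bondSpin_eq_one_iff ω _).1 hc) hv).symm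

end Literature.Probability.LatticeModels

end
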